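import Literature.AnabelianGeometry.SemiGraphs.ProfiniteSemiGraphIsoPullbackEquivalence
import Literature.AnabelianGeometry.SemiGraphs.TemperedCoveringsSubgraphBTemp
import Literature.AnabelianGeometry.SemiGraphs.HomRestrict
import HarnessLib

/-!
# Restriction of a morphism of profinite presentations to sub-semi-graphs, and pull-back versus restriction
# ([SemiAnbd] Def. 2.1 p. 24, Rmk. 2.4.2 p. 26, Prop. 3.6 (iv) p. 39; [IUTchI] §2 p. 44) — DEFINITIONS

Mochizuki, *Semi-graphs of anabelioids*, Publ. RIMS **42** (2006): §1 p. 12 (sub-semi-graphs, their inclusion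
morphisms), Def. 2.1 p. 24 ("the semi-graph of anabelioids `𝒢_ℍ` obtained by restricting `𝒢` to `ℍ`"), Rmk. 2.4.2
p. 26 (morphisms: compatibility with the branch maps up to conjugation — the 2-cells), §2 p. 30 (proof of Cor. 2.7
(i): "whose restriction to `ℍ` we denote by `ℋ′ → ℍ`"), Prop. 3.6 (iv) p. 39 (pull-back of coverings)
[cite: MochizukiSemiAnbd2006, Def. 2.1 p.24]; Mochizuki, *Inter-universal Teichmüller theory I*, §2 p. 44 ("we shall
apply the notation introduced above for `𝔾` to `ℍ` … natural commutative diagram") [cite: Mochizuki2012, IUTchI §2 p.44].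

abc-iut cell (seat abc-iut-w4-d052 gen 6; row «DECOMP-TRANSPORT-FUNCTORIALITY» = GAP-LEDGER G-w4d052-g6-1 (P4-i),
L5-lead RULINGS #104).  The §3-presentation (`ProfiniteSemiGraph`) twin of abc-iut-L3-t1's §2-presentation
`HomRestrict.lean` (`SemiGraphOfAnabelioids.Hom.restrict`), written against abc-iut-L3-d4/d6's pull-back machinery
(`Hom.covPullbackWith θ`, `Hom.ConjugatorFamily`, `Hom.btempPullbackEquiv`):

* `ProfiniteSemiGraph.Hom.restrictSub F K H hV hE : Hom (𝒢′.restrict K) (𝒢.restrict H)` — the restriction `ℋ′ → ℍ` of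
  `F : 𝒢′ → 𝒢` to sub-semi-graphs `K ⊆ 𝔾′`, `H ⊆ 𝔾` with `F(K) ⊆ H` (underlying morphism abc-iut-L3-t1's
  `SemiGraph.Hom.restrict`; the same constituent homomorphisms `F_v`, `F_e`);
* `Hom.ConjugatorFamily.restrictSub θ` — a family of 2-cells of `F` restricts to one of `F|_K`;
* `Hom.IsLocallyTrivial.restrictSub`, `Hom.isIso_restrictSub_base` (for `IsIso F.base` and `K = F⁻¹(H)` EXACTLY) — the
  hypotheses of abc-iut-L3-d6's `Hom.btempPullbackEquiv` pass to `F|_K`;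
* **`Hom.covRestrictPullbackIso` : `F^*_θ ⋙ (−)|_K ≅ (−)|_H ⋙ (F|_K)^*_{θ|_K}`** (identity components — the two
  coverings of `𝒢′_K` have the same fibres and the same gluings) and its `B^temp` form `Hom.btempRestrictPullbackIso`.

Definitions + definitional bookkeeping (review lane: this file declares `def`s); no instance, no notation, no `Prop`
fact; nothing of the papers is asserted; nothing here bears on [IUTchIII] Cor. 3.12.
-/

noncomputable section

namespace Literature.AnabelianGeometry.SemiGraphs

namespace ProfiniteSemiGraph

open CategoryTheory
open Literature.AlgebraicGeometry.Frobenioids.QuasiTemperoid.BTempConnected (hom_ext_apply)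

universe u

variable {𝒢' 𝒢 : ProfiniteSemiGraph.{u}}

/-! ### Casts along a sub-semi-graph: the branch homomorphisms of `𝒢_ℍ` re-indexed -/

/-- `b_*` of `𝒢_ℍ` re-indexed along an equality of edges OF `ℍ` is `b_*` of `𝒢` re-indexed along the underlying equality
of edges of `𝔾` (bookkeeping). [cite: MochizukiSemiAnbd2006, Def. 2.1 p.24] -/
theorem brHomAt_restrict_eq (H : 𝒢.graph.Subgraph) (b : (𝒢.restrict H).graph.Branch)
    (v : (𝒢.restrict H).graph.Vertex) (h : (𝒢.restrict H).graph.abuts b = some v)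
    (f : (𝒢.restrict H).graph.Edge) (q : (𝒢.restrict H).graph.edgeOf b = f) :
    (𝒢.restrict H).brHomAt b v h f q =
      𝒢.brHomAt b.1 v.1 ((H.abuts_eq_some_iff b v).mp h) f.1 (congrArg Subtype.val q) := by
  subst q
  rfl

/-- The same on elements: `b_*` of `𝒢_ℍ` applied to an element transported along an equality of edges of `ℍ`.
[cite: MochizukiSemiAnbd2006, Def. 2.1 p.24] -/
theorem brHom_restrict_cast (H : 𝒢.graph.Subgraph) (b : (𝒢.restrict H).graph.Branch)
    (v : (𝒢.restrict H).graph.Vertex) (h : (𝒢.restrict H).graph.abuts b = some v)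
    {f : (𝒢.restrict H).graph.Edge} (q : (𝒢.restrict H).graph.edgeOf b = f) (z : (𝒢.restrict H).Ge f) :
    (𝒢.restrict H).brHom b v h (q ▸ z) =
      𝒢.brHom b.1 v.1 ((H.abuts_eq_some_iff b v).mp h)
        ((show 𝒢.graph.edgeOf b.1 = f.1 from congrArg Subtype.val q) ▸ z) := by
  subst q
  rfl

namespace Hom

variable (F : Hom 𝒢' 𝒢) (K : 𝒢'.graph.Subgraph) (H : 𝒢.graph.Subgraph)
  (hV : K.verts ⊆ F.base.vertexMap ⁻¹' H.verts) (hE : K.edges ⊆ F.base.edgeMap ⁻¹' H.edges)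

/-! ### The restriction `F|_K : 𝒢′_K → 𝒢_H` -/

/-- **The restriction `F|_K : 𝒢′_K → 𝒢_H`** of a morphism of profinite presentations `F : 𝒢′ → 𝒢` to sub-semi-graphs
`K ⊆ 𝔾′`, `H ⊆ 𝔾` with `F(K) ⊆ H` ([SemiAnbd] p. 30 "whose restriction to `ℍ` we denote by `ℋ′ → ℍ`"): the restricted
morphism of underlying semi-graphs with the SAME constituent homomorphisms `F_v`, `F_e` and the same compatibilities up
to conjugation. [cite: MochizukiSemiAnbd2006, Cor. 2.7(i) p.30] -/
def restrictSub : Hom (𝒢'.restrict K) (𝒢.restrict H) where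
  base := SemiGraph.Hom.restrict F.base K H hV hE
  hV v := F.hV v.1
  hE e := F.hE e.1
  comm b v h := by
    obtain ⟨g, hg⟩ := F.comm b.1 v.1 ((K.abuts_eq_some_iff b v).mp h)
    refine ⟨g, fun x => ?_⟩
    rw [brHom_restrict_cast]
    · exact hg x
    · exact (SemiGraph.Hom.restrict F.base K H hV hE).edgeOf_branchMap b

/-- The vertex constituents of `F|_K` are those of `F` (definitional). [cite: MochizukiSemiAnbd2006, Cor. 2.7(i) p.30] -/
@[simp] theorem restrictSub_hV (v : (𝒢'.restrict K).graph.Vertex) : (F.restrictSub K H hV hE).hV v = F.hV v.1 := rfl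

/-- The edge constituents of `F|_K` are those of `F` (definitional). [cite: MochizukiSemiAnbd2006, Cor. 2.7(i) p.30] -/
@[simp] theorem restrictSub_hE (e : (𝒢'.restrict K).graph.Edge) : (F.restrictSub K H hV hE).hE e = F.hE e.1 := rfl

/-- The underlying morphism of semi-graphs of `F|_K` (definitional). [cite: MochizukiSemiAnbd2006, §1 p.12] -/
theorem restrictSub_base : (F.restrictSub K H hV hE).base = SemiGraph.Hom.restrict F.base K H hV hE := rfl

/-- `(F|_K)(v) = F(v)` on vertices (definitional). [cite: MochizukiSemiAnbd2006, §1 p.12] -/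
@[simp] theorem restrictSub_vertexMap_coe (v : (𝒢'.restrict K).graph.Vertex) :
    ((F.restrictSub K H hV hE).base.vertexMap v).1 = F.base.vertexMap v.1 := rfl

/-- `(F|_K)(e) = F(e)` on edges (definitional). [cite: MochizukiSemiAnbd2006, §1 p.12] -/
@[simp] theorem restrictSub_edgeMap_coe (e : (𝒢'.restrict K).graph.Edge) :
    ((F.restrictSub K H hV hE).base.edgeMap e).1 = F.base.edgeMap e.1 := rfl

/-- `(F|_K)(b) = F(b)` on branches (definitional). [cite: MochizukiSemiAnbd2006, §1 p.12] -/
@[simp] theorem restrictSub_branchMap_coe (b : (𝒢'.restrict K).graph.Branch) :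
    ((F.restrictSub K H hV hE).base.branchMap b).1 = F.base.branchMap b.1 := rfl

/-- `((F b)_* ∘ F_e)` of `F|_K` is that of `F` (the re-indexing cast read in `𝔾`). [cite: MochizukiSemiAnbd2006, Rmk 2.4.2 p.26] -/
theorem restrictSub_brComp (b : (𝒢'.restrict K).graph.Branch) (v : (𝒢'.restrict K).graph.Vertex)
    (h : (𝒢'.restrict K).graph.abuts b = some v) :
    (F.restrictSub K H hV hE).brComp b v h = F.brComp b.1 v.1 ((K.abuts_eq_some_iff b v).mp h) := by
  unfold brComp
  rw [brHomAt_restrict_eq]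
  rfl

/-- A locally trivial morphism restricts to a locally trivial one. [cite: MochizukiSemiAnbd2006, Def 2.2(ii) p.24] -/
theorem IsLocallyTrivial.restrictSub {F : Hom 𝒢' 𝒢} (hlt : F.IsLocallyTrivial) (K : 𝒢'.graph.Subgraph)
    (H : 𝒢.graph.Subgraph) (hV : K.verts ⊆ F.base.vertexMap ⁻¹' H.verts)
    (hE : K.edges ⊆ F.base.edgeMap ⁻¹' H.edges) : (F.restrictSub K H hV hE).IsLocallyTrivial :=
  ⟨fun v => hlt.1 v.1, fun e => hlt.2 e.1⟩

/-! ### 2-cells restrict -/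

/-- **A family of 2-cells of `F` restricts to one of `F|_K`** (the same conjugating elements).
[cite: MochizukiSemiAnbd2006, Rmk 2.4.2 p.26] -/
def ConjugatorFamily.restrictSub {F : Hom 𝒢' 𝒢} (θ : F.ConjugatorFamily) (K : 𝒢'.graph.Subgraph)
    (H : 𝒢.graph.Subgraph) (hV : K.verts ⊆ F.base.vertexMap ⁻¹' H.verts)
    (hE : K.edges ⊆ F.base.edgeMap ⁻¹' H.edges) : (F.restrictSub K H hV hE).ConjugatorFamily where
  θ b v h := θ.θ b.1 v.1 ((K.abuts_eq_some_iff b v).mp h)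
  spec b v h x := by
    rw [restrictSub_brComp]
    exact θ.spec b.1 v.1 _ x

/-- The restricted 2-cells are those of `θ` (definitional). [cite: MochizukiSemiAnbd2006, Rmk 2.4.2 p.26] -/
@[simp] theorem ConjugatorFamily.restrictSub_θ {F : Hom 𝒢' 𝒢} (θ : F.ConjugatorFamily) (K : 𝒢'.graph.Subgraph)
    (H : 𝒢.graph.Subgraph) (hV : K.verts ⊆ F.base.vertexMap ⁻¹' H.verts)
    (hE : K.edges ⊆ F.base.edgeMap ⁻¹' H.edges) (b : (𝒢'.restrict K).graph.Branch)
    (v : (𝒢'.restrict K).graph.Vertex) (h : (𝒢'.restrict K).graph.abuts b = some v) :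
    (θ.restrictSub K H hV hE).θ b v h = θ.θ b.1 v.1 ((K.abuts_eq_some_iff b v).mp h) := rfl

/-! ### `F|_K` is an isomorphism on underlying semi-graphs when `F` is and `K = F⁻¹(H)` -/

/-- **`F|_K` is an isomorphism of underlying semi-graphs** when `F` is one and `K = F⁻¹(H)` EXACTLY (vertex- and
edge-wise): the inverse is the restriction of `F⁻¹` to `H`. [cite: MochizukiSemiAnbd2006, §1 p.12] -/
theorem isIso_restrictSub_base [IsIso (C := SemiGraph.{u}) F.base]
    (hV' : ∀ v, F.base.vertexMap v ∈ H.verts → v ∈ K.verts) (hE' : ∀ e, F.base.edgeMap e ∈ H.edges → e ∈ K.edges) :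
    IsIso (C := SemiGraph.{u}) (F.restrictSub K H hV hE).base := by
  have hVi : H.verts ⊆ (inv (C := SemiGraph.{u}) F.base).vertexMap ⁻¹' K.verts := fun w hw =>
    hV' _ (by rw [SemiGraph.vertexMap_inv_vertexMap]; exact hw)
  have hEi : H.edges ⊆ (inv (C := SemiGraph.{u}) F.base).edgeMap ⁻¹' K.edges := fun e he =>
    hE' _ (by rw [SemiGraph.edgeMap_inv_edgeMap]; exact he)
  refine ⟨SemiGraph.Hom.restrict (inv (C := SemiGraph.{u}) F.base) H K hVi hEi, ?_, ?_⟩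
  · refine SemiGraph.hom_ext _ _ (funext fun v => Subtype.ext ?_) (funext fun e => Subtype.ext ?_)
      (funext fun b => Subtype.ext ?_)
    · exact SemiGraph.inv_vertexMap_vertexMap F.base v.1
    · exact SemiGraph.inv_edgeMap_edgeMap F.base e.1
    · exact SemiGraph.inv_branchMap_branchMap F.base b.1
  · refine SemiGraph.hom_ext _ _ (funext fun w => Subtype.ext ?_) (funext fun e => Subtype.ext ?_)
      (funext fun b => Subtype.ext ?_)
    · exact SemiGraph.vertexMap_inv_vertexMap F.base w.1
    · exact SemiGraph.edgeMap_inv_edgeMap F.base e.1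
    · exact SemiGraph.branchMap_inv_branchMap F.base b.1

/-! ### Pull-back commutes with restriction: `F^*_θ ⋙ (−)|_K ≅ (−)|_H ⋙ (F|_K)^*_{θ|_K}` -/

variable (θ : F.ConjugatorFamily)

/-- The two coverings `(F^*_θ S)|_K` and `(F|_K)^*_{θ|_K} (S|_H)` of `𝒢′_K` have the SAME gluing along every branch
(elementwise: the gluing of `S` along `F b` at the transported point followed by the 2-cell `θ_b`).
[cite: MochizukiSemiAnbd2006, Prop 3.6(iv) p.39] -/
theorem covRestrict_covPullbackWith_glue_apply (S : CovObj 𝒢) (b : (𝒢'.restrict K).graph.Branch)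
    (v : (𝒢'.restrict K).graph.Vertex) (h : (𝒢'.restrict K).graph.abuts b = some v)
    (x : ((((F.restrictSub K H hV hE).covPullbackWith (θ.restrictSub K H hV hE)).obj
      ((𝒢.covRestrict H).obj S)).SE ((𝒢'.restrict K).graph.edgeOf b)).obj.V) :
    ((((F.restrictSub K H hV hE).covPullbackWith (θ.restrictSub K H hV hE)).obj
        ((𝒢.covRestrict H).obj S)).glue b v h).hom.hom.hom x =
      ((((𝒢'.covRestrict K).obj ((F.covPullbackWith θ).obj S))).glue b v h).hom.hom.hom x := by
  rw [covPullbackWith_glue_apply_castPtE]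
  exact (F.covPullbackWith_glue_apply_castPtE θ S b.1 v.1 ((K.abuts_eq_some_iff b v).mp h) x).symm

/-- **Pull-back commutes with restriction** ([SemiAnbd] Rem. 2.11.1 / [IUTchI] §2 p. 44 "natural commutative
diagram"): `F^*_θ ⋙ (−)|_K ≅ (−)|_H ⋙ (F|_K)^*_{θ|_K}` as functors `B^cov(𝒢) ⥤ B^cov(𝒢′_K)`, with IDENTITY components
(same fibres, same gluings). [cite: MochizukiSemiAnbd2006, Prop 3.6(iv) p.39] -/
def covRestrictPullbackIso :
    F.covPullbackWith θ ⋙ 𝒢'.covRestrict K ≅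
      𝒢.covRestrict H ⋙ (F.restrictSub K H hV hE).covPullbackWith (θ.restrictSub K H hV hE) :=
  NatIso.ofComponents
    (fun S => CovObj.isoOfComponents (fun _ => Iso.refl _) (fun _ => Iso.refl _) (fun b v h =>
      hom_ext_apply fun x => F.covRestrict_covPullbackWith_glue_apply K H hV hE θ S b v h x))
    (fun f => by
      refine CovHom.ext (funext fun v => ?_) (funext fun e => ?_)
      · change _ ≫ 𝟙 _ = 𝟙 _ ≫ _
        rw [Category.comp_id, Category.id_comp]
        rfl
      · change _ ≫ 𝟙 _ = 𝟙 _ ≫ _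
        rw [Category.comp_id, Category.id_comp]
        rfl)

/-- The components of `covRestrictPullbackIso` are identities on vertex fibres (definitional).
[cite: MochizukiSemiAnbd2006, Prop 3.6(iv) p.39] -/
@[simp] theorem covRestrictPullbackIso_hom_app_fV (S : CovObj 𝒢) (v : (𝒢'.restrict K).graph.Vertex) :
    ((F.covRestrictPullbackIso K H hV hE θ).hom.app S).fV v = 𝟙 _ := rfl

/-- … and on edge fibres (definitional). [cite: MochizukiSemiAnbd2006, Prop 3.6(iv) p.39] -/
@[simp] theorem covRestrictPullbackIso_hom_app_fE (S : CovObj 𝒢) (e : (𝒢'.restrict K).graph.Edge) :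
    ((F.covRestrictPullbackIso K H hV hE θ).hom.app S).fE e = 𝟙 _ := rfl

/-- **The `B^temp` form**: `F^*_θ ⋙ (−)|_K ≅ (−)|_H ⋙ (F|_K)^*_{θ|_K}` as functors `B^temp(𝒢) ⥤ B^temp(𝒢′_K)`.
[cite: MochizukiSemiAnbd2006, Prop 3.6(iv) p.39] -/
def btempRestrictPullbackIso :
    F.btempPullbackWith θ ⋙ 𝒢'.btempRestrict K ≅
      𝒢.btempRestrict H ⋙ (F.restrictSub K H hV hE).btempPullbackWith (θ.restrictSub K H hV hE) :=
  NatIso.ofComponents (fun S => ObjectProperty.isoMk _ ((F.covRestrictPullbackIso K H hV hE θ).app S.obj))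
    (fun f => ObjectProperty.hom_ext _ ((F.covRestrictPullbackIso K H hV hE θ).hom.naturality f.hom))

end Hom

end ProfiniteSemiGraph

end Literature.AnabelianGeometry.SemiGraphs

end
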